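import Mathlib
import Summits.AnomalousDissipation.AnomalousDissipation.Theorems.SoloBlindLiftoffInner

/-!
# Lift-off inner solution: the O(ε) far field — kernel #116 (solo-blind s65)

Leading order (kernel #111): on the live side `η > 1` the lift-off inner solution is
`α₀ = √Q₀`, `Q₀(η) = η³ + 3η - 4`, `m₀ = 6`.  At the next order in `ε = γh²/(ℓ²W₀)`
(`= e₁ ℓ`, dimensionless) the amplitude equation `ε α'' + w α = 0` forces the shear correction
`m̃₁ = -6 ε α₀''/α₀ =: -6 ε R(η)`, and the smoothing relation `P''' = m̃ - m̃'''` for the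
correction `P = α² - Q_out` of the squared amplitude then has the particular far-field solution
`(9ε/2)(η ln η - η)`, because `R(η) = 3/(4η²) + O(η⁻³)` and `(η ln η - η)''' = -1/η²`.
This file certifies: the closed form `R = (2Q₀Q₀'' - Q₀'²)/(4Q₀²) = (3η⁴+18η²-48η-9)/(4Q₀²)`
(first and second derivative of `√Q₀` on `η > 1`, and the general algebraic identity behind
`(√Q)''/√Q = (2QQ'' - Q'²)/(4Q²)`), the exact identity and the bound `|η²R - 3/4| ≤ 12/η³`
(`η ≥ 2`), the three derivatives of `η ln η - η`, the coefficient match `-(9ε/2)/η² = -6ε·3/(4η²)`,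
and the onset sensitivity factor `2Q₀(H)/Q₀'(H)` of the far-field datum (`= 16.05…` at `H = 24`).
-/

namespace Summit.AnomalousDissipation.AnomalousDissipation.Theorems

open Real

/-- numerator of `R = α₀''/α₀`: `2 Q₀ Q₀'' - Q₀'² = 3η⁴ + 18η² - 48η - 9`
(`Q₀ = η³+3η-4`, `Q₀' = 3η²+3`, `Q₀'' = 6η`). -/
theorem liftoff_R_numerator (η : ℝ) :
    2 * (η ^ 3 + 3 * η - 4) * (6 * η) - (3 * η ^ 2 + 3) ^ 2 = 3 * η ^ 4 + 18 * η ^ 2 - 48 * η - 9 := by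
  ring

/-- the algebra behind `(√Q)''/√Q = (2QQ'' - Q'²)/(4Q²)`: with `s = √Q` (`s > 0`, `s² = Q`) the
quotient-rule expression for the derivative of `Q'/(2s)`, divided by `s`, equals `(2QQ''-Q'²)/(4Q²)`. -/
theorem sqrt_ratio_second_deriv {Q Q' Q'' s : ℝ} (hs : 0 < s) (hQ : s ^ 2 = Q) :
    ((Q'' * (2 * s) - Q' * (2 * (Q' / (2 * s)))) / (2 * s) ^ 2) / s
      = (2 * Q * Q'' - Q' ^ 2) / (4 * Q ^ 2) := by
  subst hQ
  have hs' : s ≠ 0 := ne_of_gt hs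
  field_simp
  ring

/-- first derivative of the live-side amplitude `α₀ = √(η³+3η-4)` for `η > 1`:
`α₀' = Q₀'/(2√Q₀)`. -/
theorem liftoff_alpha0_hasDerivAt {η : ℝ} (hη : 1 < η) :
    HasDerivAt (fun x : ℝ => sqrt (x ^ 3 + 3 * x - 4))
      ((3 * η ^ 2 + 3) / (2 * sqrt (η ^ 3 + 3 * η - 4))) η :=
  (liftoff_Q_hasDerivAt η).sqrt (ne_of_gt (liftoff_Q_pos hη))

/-- second derivative: the derivative of `α₀' = Q₀'/(2√Q₀)` on `η > 1`, in quotient-rule form. -/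
theorem liftoff_alpha0'_hasDerivAt {η : ℝ} (hη : 1 < η) :
    HasDerivAt (fun x : ℝ => (3 * x ^ 2 + 3) / (2 * sqrt (x ^ 3 + 3 * x - 4)))
      ((6 * η * (2 * sqrt (η ^ 3 + 3 * η - 4))
        - (3 * η ^ 2 + 3) * (2 * ((3 * η ^ 2 + 3) / (2 * sqrt (η ^ 3 + 3 * η - 4)))))
        / (2 * sqrt (η ^ 3 + 3 * η - 4)) ^ 2) η := by
  have hQ := liftoff_Q_pos hη
  have hs : sqrt (η ^ 3 + 3 * η - 4) ≠ 0 := (Real.sqrt_pos.mpr hQ).ne'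
  have hden : HasDerivAt (fun x : ℝ => 2 * sqrt (x ^ 3 + 3 * x - 4))
      (2 * ((3 * η ^ 2 + 3) / (2 * sqrt (η ^ 3 + 3 * η - 4)))) η :=
    (liftoff_alpha0_hasDerivAt hη).const_mul 2
  exact (liftoff_Q'_hasDerivAt η).div hden (mul_ne_zero two_ne_zero hs)

/-- closed form of `R = α₀''/α₀` on the live side:
`R(η) = (3η⁴ + 18η² - 48η - 9)/(4(η³+3η-4)²)`. -/
theorem liftoff_R_closed_form {η : ℝ} (hη : 1 < η) :
    ((6 * η * (2 * sqrt (η ^ 3 + 3 * η - 4))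
        - (3 * η ^ 2 + 3) * (2 * ((3 * η ^ 2 + 3) / (2 * sqrt (η ^ 3 + 3 * η - 4)))))
        / (2 * sqrt (η ^ 3 + 3 * η - 4)) ^ 2) / sqrt (η ^ 3 + 3 * η - 4)
      = (3 * η ^ 4 + 18 * η ^ 2 - 48 * η - 9) / (4 * (η ^ 3 + 3 * η - 4) ^ 2) := by
  have hQ := liftoff_Q_pos hη
  have hs0 : 0 < sqrt (η ^ 3 + 3 * η - 4) := Real.sqrt_pos.mpr hQ
  have hs2 : sqrt (η ^ 3 + 3 * η - 4) ^ 2 = η ^ 3 + 3 * η - 4 := Real.sq_sqrt hQ.le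
  rw [sqrt_ratio_second_deriv hs0 hs2, liftoff_R_numerator]

/-- exact identity behind `η² R(η) → 3/4`:
`η²(3η⁴+18η²-48η-9) - 3(η³+3η-4)² = -12(2η³+3η²-6η+4)`. -/
theorem liftoff_R_asymp_identity (η : ℝ) :
    η ^ 2 * (3 * η ^ 4 + 18 * η ^ 2 - 48 * η - 9) - 3 * (η ^ 3 + 3 * η - 4) ^ 2
      = -12 * (2 * η ^ 3 + 3 * η ^ 2 - 6 * η + 4) := by
  ring

/-- quantitative asymptotics of the shear-correction kernel: `|η² R(η) - 3/4| ≤ 12/η³` for `η ≥ 2`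
(so `-6εR = -(9ε/2)/η² + O(ε/η⁵)`: the far-field forcing of `P'''` is `-(9ε/2)η⁻²`). -/
theorem liftoff_R_asymp_bound {η : ℝ} (hη : 2 ≤ η) :
    |η ^ 2 * ((3 * η ^ 4 + 18 * η ^ 2 - 48 * η - 9) / (4 * (η ^ 3 + 3 * η - 4) ^ 2)) - 3 / 4|
      ≤ 12 / η ^ 3 := by
  have hQ : η ^ 3 ≤ η ^ 3 + 3 * η - 4 := by linarith
  have hη3 : 0 < η ^ 3 := by positivity
  have hQpos : 0 < η ^ 3 + 3 * η - 4 := lt_of_lt_of_le hη3 hQ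
  have hQ2 : 0 < (η ^ 3 + 3 * η - 4) ^ 2 := by positivity
  have hQne : η ^ 3 + 3 * η - 4 ≠ 0 := hQpos.ne'
  have hQ2ne : (η ^ 3 + 3 * η - 4) ^ 2 ≠ 0 := hQ2.ne'
  have key : η ^ 2 * ((3 * η ^ 4 + 18 * η ^ 2 - 48 * η - 9) / (4 * (η ^ 3 + 3 * η - 4) ^ 2)) - 3 / 4
      = -(3 * (2 * η ^ 3 + 3 * η ^ 2 - 6 * η + 4) / (η ^ 3 + 3 * η - 4) ^ 2) := by
    obtain ⟨q, hq⟩ : ∃ q : ℝ, q = η ^ 3 + 3 * η - 4 := ⟨_, rfl⟩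
    have hqne : q ≠ 0 := hq ▸ hQne
    rw [← hq]
    field_simp
    subst hq
    ring
  have hnum : 0 ≤ 3 * (2 * η ^ 3 + 3 * η ^ 2 - 6 * η + 4) := by nlinarith
  rw [key, abs_neg, abs_of_nonneg (div_nonneg hnum hQ2.le), div_le_div_iff₀ hQ2 hη3]
  have h1 : 12 * (η ^ 3 * η ^ 3) ≤ 12 * (η ^ 3 + 3 * η - 4) ^ 2 := by nlinarith [mul_le_mul hQ hQ hη3.le hQpos.le]
  have h2 : 3 * (2 * η ^ 3 + 3 * η ^ 2 - 6 * η + 4) * η ^ 3 ≤ 12 * (η ^ 3 * η ^ 3) := by nlinarith [sq_nonneg η]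
  linarith

/-- first derivative of the far-field profile `η ln η - η`: `(η ln η - η)' = ln η` (`η ≠ 0`). -/
theorem etaLogEta_hasDerivAt {η : ℝ} (hη : η ≠ 0) :
    HasDerivAt (fun x : ℝ => x * log x - x) (log η) η := by
  have h := (Real.hasDerivAt_mul_log hη).sub (hasDerivAt_id' η)
  convert h using 1 <;> first | rfl | ring

/-- second derivative: `(ln η)' = η⁻¹`. -/
theorem etaLogEta_second_hasDerivAt {η : ℝ} (hη : η ≠ 0) :
    HasDerivAt (fun x : ℝ => log x) η⁻¹ η := Real.hasDerivAt_log hη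

/-- third derivative: `(η⁻¹)' = -(η²)⁻¹`, so `(η ln η - η)''' = -1/η²`. -/
theorem etaLogEta_third_hasDerivAt {η : ℝ} (hη : η ≠ 0) :
    HasDerivAt (fun x : ℝ => x⁻¹) (-(η ^ 2)⁻¹) η := hasDerivAt_inv hη

/-- the scaled profile `P₁(η) = (9ε/2)(η ln η - η)`: first derivative `(9ε/2) ln η`. -/
theorem liftoff_P1_hasDerivAt (ε : ℝ) {η : ℝ} (hη : η ≠ 0) :
    HasDerivAt (fun x : ℝ => 9 * ε / 2 * (x * log x - x)) (9 * ε / 2 * log η) η :=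
  (etaLogEta_hasDerivAt hη).const_mul (9 * ε / 2)

/-- … second derivative `(9ε/2) η⁻¹`. -/
theorem liftoff_P1'_hasDerivAt (ε : ℝ) {η : ℝ} (hη : η ≠ 0) :
    HasDerivAt (fun x : ℝ => 9 * ε / 2 * log x) (9 * ε / 2 * η⁻¹) η :=
  (Real.hasDerivAt_log hη).const_mul (9 * ε / 2)

/-- … third derivative `-(9ε/2)(η²)⁻¹`. -/
theorem liftoff_P1''_hasDerivAt (ε : ℝ) {η : ℝ} (hη : η ≠ 0) :
    HasDerivAt (fun x : ℝ => 9 * ε / 2 * x⁻¹) (9 * ε / 2 * (-(η ^ 2)⁻¹)) η :=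
  (hasDerivAt_inv hη).const_mul (9 * ε / 2)

/-- COEFFICIENT MATCH: the third derivative of `P₁ = (9ε/2)(η ln η - η)` equals the leading
far-field forcing `-6ε · 3/(4η²)` of `P''' = m̃₁ - m̃₁'''` (`m̃₁ = -6εR`, `R ∼ 3/(4η²)`). -/
theorem liftoff_P1_coefficient (ε η : ℝ) :
    9 * ε / 2 * (-(η ^ 2)⁻¹) = -6 * ε * (3 / (4 * η ^ 2)) := by
  ring

/-- ONSET SENSITIVITY to the far-field datum: within the leading-order family `Q₀(η - s)`,
pinning `Q(H)` gives `s = -δQ(H)/Q₀'(H) = -2 δlnα(H) · Q₀(H)/Q₀'(H)`; the factor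
`2Q₀(H)/Q₀'(H) = (2/3)(H-1)(H²+H+4)/(H²+1)`. -/
theorem liftoff_onset_sensitivity (H : ℝ) :
    2 * (H ^ 3 + 3 * H - 4) / (3 * H ^ 2 + 3) = 2 / 3 * ((H - 1) * (H ^ 2 + H + 4)) / (H ^ 2 + 1) := by
  have h : H ^ 2 + 1 ≠ 0 := by positivity
  have h3 : 3 * H ^ 2 + 3 ≠ 0 := by positivity
  field_simp
  ring

/-- at the box edge `H = 24`: `2Q₀(24)/Q₀'(24) = 27784/1731` (`≈ 16.05`: a relative error of
`10⁻³` in `α(24)` moves the onset by `.016 ℓ`). -/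
theorem liftoff_onset_sensitivity_24 :
    2 * ((24 : ℝ) ^ 3 + 3 * 24 - 4) / (3 * 24 ^ 2 + 3) = 27784 / 1731 := by norm_num

/-- … and `16 < 27784/1731 < 16.1`. -/
theorem liftoff_onset_sensitivity_24_bounds :
    (16 : ℝ) < 27784 / 1731 ∧ (27784 : ℝ) / 1731 < 16.1 := by
  constructor <;> norm_num

end Summit.AnomalousDissipation.AnomalousDissipation.Theorems
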